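import Mathlib
import Literature.Analysis.FluidPDE.VectorCalculus
import Literature.Analysis.FluidPDE.VorticityStretching
import Literature.Analysis.FluidPDE.PoincareHomotopyOperator
import Summits.NavierStokesRegularity.NavierStokesRegularity.Theorems.ThreadingFluxAzimuthalCartanDefs
import Summits.NavierStokesRegularity.NavierStokesRegularity.Theorems.ThreadingFluxAzimuthalCartanShellReduction
import Summits.NavierStokesRegularity.NavierStokesRegularity.Theorems.ThreadingFluxAzimuthalCartanLocalCurlCurl
import Summits.NavierStokesRegularity.NavierStokesRegularity.Theorems.ThreadingFluxErtelTowerVorticityFrozen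
import Summits.NavierStokesRegularity.NavierStokesRegularity.Theorems.ThreadingFluxHorizonTowerZonalFrame
import HarnessLib

/-!
# Crux `PoloidalLiouville` (stmt-NavierStokesRegularity-1222, wall W1), crux idea «azimuthal-cartan-test» (ns-idea-15 g10):
# RIGID-VORTICITY RIGIDITY — the conclusion of C♭ / C♭₀ / C♯ holds wherever the vorticity is an infinitesimal rotation

Support file (`--supports stmt-NavierStokesRegularity-1222`, helper; experiment cell `ns-wall-extremal`, width hand ns-wall-eng-7 g8,
0 kit; sized S–M / NO STRIKE by ns-wall-crit-1 g7 BATCH #6).  Vocabulary = the Theorems-side twin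
`ThreadingFluxAzimuthalCartanDefs.lean` (p707806) of the sketch `Cruxes/PoloidalLiouville/AzimuthalCartanSketch.lean` v1.3c:
`IsSteadyNSOn`, `IsSkewAxis`, `IsEquivariantOn`, `HasConstantSwirlOn`, `IsUnthreadedOn`, `shell`.

## The statement (ρ)

Let `(V, p)` be a classical steady Navier–Stokes flow on an open set `U ⊆ ℝ³` (`IsSteadyNSOn U V p`: `V ∈ C³`, `p ∈ C¹`,
`div V = 0`, `(V·∇)V + ∇p = ΔV` on `U`) whose vorticity is an INFINITESIMAL ROTATION about `x₀` on `U`: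
`curl V y = k × (y − x₀)` for `y ∈ U`, `k ≠ 0` (the vorticity of the Hagen–Poiseuille flow, of a rigid rotation, …).  Then

* ★ `fderiv_cross_eq_of_rigidVorticity` — `V` is infinitesimally EQUIVARIANT about the axis `x₀ + ℝk` at every point of `U`:
  `DV(x)[k × (x − x₀)] = k × V(x)` (no connectedness needed);
* ★ `hasConstantSwirlOn_of_rigidVorticity` — on a CONNECTED `U` the swirl `⟪V x, k × (x − x₀)⟫` is constant
  (`HasConstantSwirlOn U x₀ (crossCLM k) V`); it is `0` as soon as the axis meets `U` (`swirl_eq_zero_of_rigidVorticity`);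
* ★★ `rigidity_of_rigidVorticity` — hence `IsSkewAxis (crossCLM k) ∧ IsEquivariantOn U x₀ (crossCLM k) V ∧
  HasConstantSwirlOn U x₀ (crossCLM k) V`, i.e. the common CONCLUSION of the card's C♭ `SteadyLocalRigidityOffCentre`, C♭₀
  `SteadyLocalRigidityOffCentreUnrestricted` and C♯ `SteadyShellRigidity`, on ANY connected open `U` — balls containing the centre
  `x₀` (the centre regime) included; `rigidity_of_skewVorticity` is the same with the vorticity written `A (y − x₀)`, `A` skew;
* the corollaries in the card's shapes: `steadyLocalRigidity_of_rigidVorticity_ball` (every ball, every centre — the shape of C♭₀,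
  which is FALSE in general: `AzimuthalCartan.not_steadyLocalRigidityOffCentreUnrestricted`, p717512) and
  ★ `steadyShellRigidity_of_rigidVorticity` (C♯ HOLDS on the rigid-vorticity stratum of every full shell `shell x₀ r₁ r₂`, `0 ≤ r₁`;
  with `isPreconnected_shell`), the companion of ns-wall-eng-6 g4's homogeneous stratum
  `Homogeneous.steadyShellRigidity_of_homogeneous` (p711757); `isUnthreadedOn_of_rigidVorticity` records that the stratum lies
  inside the card's hypothesis (a rigid rotation field about `x₀` is tangent to the spheres about `x₀`).

## Proof (paper, re-derived by ns-wall-crit-1 g7 BATCH #6; every step is a theorem below)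

`curl (k × (y − x₀)) = 2k` (`curl_cross_sub`, the tree's `curlCLM_crossCLM`), so with `div V = 0` the LOCAL identity
`ΔV = −curl curl V` (`LocalCurlCurl.laplacian_eq_neg_curl_local`, p708034) gives `ΔV = −2k` on `U` (`laplacian_eq_of_rigidVorticity`);
the momentum equation then reads `∇p = −2k − (V·∇)V` (`gradient_eq_of_rigidVorticity`), so `p ∈ C²` (`contDiffAt_two_pressure…`)
and `curl ∇p = 0` (`ErtelTower.curl_gradient_of_contDiffAt`) gives `curl ((V·∇)V) = 0` on `U` (`curl_convect_eq_zero_of_rigidVorticity`).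
The tree's identity `curl ((V·∇)V) = (V·∇)ω − (ω·∇)V + (div V) ω` (`curl_convect_self`, Majda–Bertozzi §1.1; localised here as
`curl_convect_self_local` by the bump-representative device `CentreJet.exists_contDiff_eventuallyEq_of_ball`) with `ω = k × (y − x₀)`
reads `0 = k × V − DV[k × (x − x₀)]` — the steady vorticity equation `[ω, V] = νΔω = 0` (Kambe §8.8.1) with `ω` a rotation
generator — which is the equivariance.  For the swirl `s = ⟪V, k × (· − x₀)⟫`: `Ds(x)h = ⟪DV h, ω⟫ + ⟪V, k × h⟫`, and the SPIN
IDENTITY `⟪L h, w⟫ − ⟪h, L w⟫ = ⟪(curlCLM L) × h, w⟫` (`inner_sub_inner_eq_inner_cross_curlCLM`; Majda–Bertozzi (1.24):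
`(DV − DVᵀ) h = ω × h`) with `w = ω` gives `⟪DV h, ω⟫ = ⟪h, DV ω⟫ = ⟪h, k × V⟫ = −⟪V, k × h⟫`; so `Ds = 0` on `U`
(`hasFDerivAt_swirl_zero_of_rigidVorticity`) and `s` is constant on a connected `U` (Mathlib
`IsOpen.exists_is_const_of_fderiv_eq_zero`) — connectedness is used only here.

SHARPNESS (one line, as priced): K♭'s sectorial cross flows `crossFlow γ` (p717512) are steady, unthreaded, with AZIMUTHAL but
non-rigid vorticity `−G′_γ(ρ) e_φ` about the same axis, and are NOT equivariant — «rigid», not «azimuthal», is the hypothesis that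
survives.  NON-VACUITY: the Hagen–Poiseuille base `poiseuille` of the card has `curl V = (2e₃) × y` (file
`…RigidVorticityQuadratic.lean`, `curl_poiseuille`).

HONEST FRAME: an information-grade POSITIVE STRATUM of C♯/C♭ (folklore-grade rigidity: steady NS with Poiseuille-type vorticity
about `x₀` is rotationally equivariant about the axis through `x₀` with constant swirl), strictly below the wall; W1 movement 0;
C♯, I♭, `PoloidalLiouville` (1222), its steady stratum and NS regularity are OPEN and untouched.  No new definitions, no Props.

## References
* A. J. Majda, A. L. Bertozzi, *Vorticity and Incompressible Flow* (CUP 2002), §1.1 (vector identities), §1.2 eq. (1.24)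
  (`(∇v − ∇vᵀ)h = ω × h`), §2.1 eq. (2.5) (curl of the momentum equation). [MajdaBertozziCUP2002]
* T. Kambe, *Geometrical Theory of Dynamical Systems and Fluid Flows* (World Scientific 2004), §8.8.1 (steady flows: `[u, ω] = 0`).
  [Kambe2004]
-/

-- the summit and its single sub-problem share the name (CONVENTIONS §1)
set_option linter.dupNamespace false

noncomputable section

namespace Summit.NavierStokesRegularity.NavierStokesRegularity.Theorems.PoloidalLiouville.AzimuthalCartan.RigidVorticity

open Set Function Filter Topology Metric
open scoped RealInnerProductSpace
open Literature.Analysis.FluidPDE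
open Summit.NavierStokesRegularity.NavierStokesRegularity.Theorems.PoloidalLiouville.CentreJet
  (E3 IsSteadyNSOn exists_contDiff_eventuallyEq_of_ball eventually_eventuallyEq_of_eventuallyEq)
open LocalCurlCurl (laplacian_eq_neg_curl_local curl_eventuallyEq_of_eventuallyEq divergence_eventuallyEq_of_eventuallyEq)
open HorizonTower.Zonal (inner_cross_self_left inner_cross_self_right)

/-! ## Algebra of the cross product and of `curlCLM` (`⟪k × x, x⟫ = 0`, `⟪k × x, k⟫ = 0` are the tree's `HorizonTower.Zonal.inner_cross_self_right/left`) -/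

/-- Skewness of `k × ·`: `⟪a, k × h⟫ + ⟪h, k × a⟫ = 0`. -/
theorem inner_cross_add_inner_cross (k a h : E3) : ⟪a, cross k h⟫ + ⟪h, cross k a⟫ = 0 := by
  simp [cross, cross_apply, EuclideanSpace.inner_eq_star_dotProduct, dotProduct, Fin.sum_univ_three]
  ring

/-- **The spin identity** (Majda–Bertozzi §1.2 (1.24): `(L − Lᵀ) h = (curl L) × h`):
`⟪L h, w⟫ − ⟪h, L w⟫ = ⟪(curlCLM L) × h, w⟫` for every linear map `L` of `ℝ³`. -/
theorem inner_sub_inner_eq_inner_cross_curlCLM (L : E3 →L[ℝ] E3) (h w : E3) :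
    ⟪L h, w⟫ - ⟪h, L w⟫ = ⟪cross (curlCLM L) h, w⟫ := by
  have hc : ∀ (v : E3) (i : Fin 3), L v i = ∑ m, v m * L (EuclideanSpace.single m 1) i :=
    fun v i => clm_apply_coord L v i
  simp only [EuclideanSpace.inner_eq_star_dotProduct, dotProduct, Fin.sum_univ_three, star_trivial, curlCLM_apply,
    cross, cross_apply]
  rw [hc h 0, hc h 1, hc h 2, hc w 0, hc w 1, hc w 2]
  simp [Fin.sum_univ_three]
  ring

/-- `crossCLM k` is a non-zero skew endomorphism for `k ≠ 0` (the card's `IsSkewAxis`). -/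
theorem isSkewAxis_crossCLM {k : E3} (hk : k ≠ 0) : IsSkewAxis (crossCLM k) := by
  refine ⟨fun x => by rw [crossCLM_apply]; exact inner_cross_self_right k x, fun h0 => hk ?_⟩
  have h : ∀ v : E3, cross k v = 0 := fun v => by rw [← crossCLM_apply, h0]; rfl
  have h₀ := h (EuclideanSpace.single 0 1)
  have h₁ := h (EuclideanSpace.single 1 1)
  have e1 : k 2 = 0 := by
    have := congrArg (fun v : E3 => v 1) h₀
    simpa [cross, cross_apply] using this
  have e2 : k 1 = 0 := by
    have := congrArg (fun v : E3 => v 2) h₀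
    simpa [cross, cross_apply] using this
  have e0 : k 0 = 0 := by
    have := congrArg (fun v : E3 => v 2) h₁
    simpa [cross, cross_apply] using this
  ext i
  fin_cases i
  · simpa using e0
  · simpa using e2
  · simpa using e1

/-- The derivative of the rigid rotation field `y ↦ k × (y − x₀)` is `crossCLM k`. -/
theorem hasFDerivAt_cross_sub (k x₀ x : E3) : HasFDerivAt (fun y : E3 => cross k (y - x₀)) (crossCLM k) x := by
  have h := (crossCLM k).hasFDerivAt.comp x ((hasFDerivAt_id x).sub_const x₀)
  simpa [Function.comp_def] using h

/-- The curl of the rigid rotation field `y ↦ k × (y − x₀)` is `2k`. -/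
theorem curl_cross_sub (k x₀ x : E3) : curl (fun y : E3 => cross k (y - x₀)) x = (2 : ℝ) • k := by
  rw [curl_eq_curlCLM, (hasFDerivAt_cross_sub k x₀ x).fderiv, curlCLM_crossCLM]

/-! ## Local calculus -/

/-- **Local `curl ((V·∇)V) = (V·∇)ω − (ω·∇)V + (div V) ω`** for `V` of class `C²` on a ball about `x` (the tree's
`curl_convect_self`, localised by a global `C²` representative agreeing with `V` near `x`). -/
theorem curl_convect_self_local {V : E3 → E3} {x : E3} {r : ℝ} (hr : 0 < r) (hV : ContDiffOn ℝ 2 V (ball x r)) :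
    curl (convect V V) x = convect V (curl V) x - convect (curl V) V x + VectorCalculus.divergence V x • curl V x := by
  obtain ⟨W, hW, hWV⟩ := exists_contDiff_eventuallyEq_of_ball (n := 2) hr hV
  have h := curl_convect_self (u := W) (by exact_mod_cast hW) x
  have h1 : convect W W =ᶠ[𝓝 x] convect V V := by
    filter_upwards [eventually_eventuallyEq_of_eventuallyEq hWV] with z hz
    rw [convect_apply, convect_apply, hz.fderiv_eq, hz.eq_of_nhds]
  have hc : curl W =ᶠ[𝓝 x] curl V := curl_eventuallyEq_of_eventuallyEq hWV
  rw [(curl_eventuallyEq_of_eventuallyEq h1).eq_of_nhds, convect_apply, convect_apply, hc.fderiv_eq, hWV.eq_of_nhds,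
    hc.eq_of_nhds, hWV.fderiv_eq, (divergence_eventuallyEq_of_eventuallyEq hWV).eq_of_nhds] at h
  rw [convect_apply, convect_apply]
  exact h

/-! ## The rigid-vorticity stratum: equivariance -/

section Main

variable {V : E3 → E3} {p : E3 → ℝ} {U : Set E3} {x₀ k : E3}

/-- **Step 1 (`ΔV = −2k`).**  If `V` is a steady NS velocity on an open `U` whose vorticity is the rigid rotation field
`k × (y − x₀)` on `U`, then `ΔV = −curl curl V = −2k` on `U`. -/
theorem laplacian_eq_of_rigidVorticity (hU : IsOpen U) (hNS : IsSteadyNSOn U V p)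
    (hω : ∀ y ∈ U, curl V y = cross k (y - x₀)) {x : E3} (hx : x ∈ U) :
    Laplacian.laplacian V x = -((2 : ℝ) • k) := by
  obtain ⟨hV3, -, hdiv, -⟩ := hNS
  obtain ⟨r, hr, hball⟩ := Metric.isOpen_iff.1 hU x hx
  have hV2 : ContDiffOn ℝ 2 V (ball x r) := (hV3.mono hball).of_le (by norm_num)
  rw [laplacian_eq_neg_curl_local hr hV2 (fun z hz => hdiv z (hball hz)) (w := fun z => cross k (z - x₀))
    (fun z hz => hω z (hball hz)), curl_cross_sub]

/-- **Step 2 (the pressure gradient).**  Under the same hypotheses `∇p = −2k − (V·∇)V` on `U`. -/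
theorem gradient_eq_of_rigidVorticity (hU : IsOpen U) (hNS : IsSteadyNSOn U V p)
    (hω : ∀ y ∈ U, curl V y = cross k (y - x₀)) {x : E3} (hx : x ∈ U) :
    gradient p x = -((2 : ℝ) • k) - convect V V x := by
  have hmom := hNS.2.2.2 x hx
  rw [laplacian_eq_of_rigidVorticity hU hNS hω hx] at hmom
  rw [convect_apply, ← hmom]
  abel

/-- **Step 3 (the pressure is `C²`).**  Under the same hypotheses `p` is of class `C²` at every point of `U` (its gradient
`−2k − (V·∇)V` is `C²` there). -/
theorem contDiffAt_two_pressure_of_rigidVorticity (hU : IsOpen U) (hNS : IsSteadyNSOn U V p)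
    (hω : ∀ y ∈ U, curl V y = cross k (y - x₀)) {x : E3} (hx : x ∈ U) : ContDiffAt ℝ 2 p x := by
  have hV3 : ContDiffAt ℝ 3 V x := hNS.1.contDiffAt (hU.mem_nhds hx)
  have hp1 : ContDiffOn ℝ 1 p U := hNS.2.1
  rw [show (2 : WithTop ℕ∞) = ((1 : ℕ) : WithTop ℕ∞) + 1 from rfl, contDiffAt_succ_iff_hasFDerivAt]
  refine ⟨fun y => (InnerProductSpace.toDual ℝ E3) (-((2 : ℝ) • k) - convect V V y),
    ⟨U, hU.mem_nhds hx, fun y hy => ?_⟩, ?_⟩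
  · have hpd : DifferentiableAt ℝ p y := (hp1.differentiableOn one_ne_zero).differentiableAt (hU.mem_nhds hy)
    have h := hpd.hasFDerivAt
    show HasFDerivAt p ((InnerProductSpace.toDual ℝ E3) (-((2 : ℝ) • k) - convect V V y)) y
    rw [← gradient_eq_of_rigidVorticity hU hNS hω hy, gradient, LinearIsometryEquiv.apply_symm_apply]
    exact h
  · have hconv : ContDiffAt ℝ 1 (convect V V) x := by
      have h1 : ContDiffAt ℝ 2 (fderiv ℝ V) x := hV3.fderiv_right (by norm_num)
      have h2 : ContDiffAt ℝ 2 (fun y => fderiv ℝ V y (V y)) x := h1.clm_apply (hV3.of_le (by norm_num))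
      exact (h2.of_le (by norm_num)).congr_of_eventuallyEq (Filter.Eventually.of_forall fun y => convect_apply V V y)
    exact (InnerProductSpace.toDual ℝ E3).contDiff.contDiffAt.comp x (contDiffAt_const.sub hconv)

/-- **Step 4 (`curl ((V·∇)V) = 0`).**  Under the same hypotheses the convective term is curl-free on `U`
(curl of the momentum equation: `curl ∇p = 0`, `curl ΔV = curl (−2k) = 0`). -/
theorem curl_convect_eq_zero_of_rigidVorticity (hU : IsOpen U) (hNS : IsSteadyNSOn U V p)
    (hω : ∀ y ∈ U, curl V y = cross k (y - x₀)) {x : E3} (hx : x ∈ U) : curl (convect V V) x = 0 := by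
  have hev : convect V V =ᶠ[𝓝 x] fun y => -((2 : ℝ) • k) - gradient p y := by
    filter_upwards [hU.mem_nhds hx] with y hy
    rw [gradient_eq_of_rigidVorticity hU hNS hω hy]
    abel
  have hpg : DifferentiableAt ℝ (gradient p) x := by
    have h2 := contDiffAt_two_pressure_of_rigidVorticity hU hNS hω hx
    have hD : DifferentiableAt ℝ (fderiv ℝ p) x := (h2.fderiv_right (m := 1) (by norm_num)).differentiableAt (by simp)
    exact (InnerProductSpace.toDual ℝ E3).symm.differentiable.differentiableAt.comp x hD
  rw [(curl_eventuallyEq_of_eventuallyEq hev).eq_of_nhds, curl_eq_curlCLM, fderiv_const_sub, map_neg, ← curl_eq_curlCLM,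
    ErtelTower.curl_gradient_of_contDiffAt (contDiffAt_two_pressure_of_rigidVorticity hU hNS hω hx), neg_zero]

/-- ★ **Equivariance on the rigid-vorticity stratum.**  A steady NS velocity `V` on an open set `U` whose vorticity is the
infinitesimal rotation `curl V y = k × (y − x₀)` on `U` is infinitesimally equivariant about the axis `x₀ + ℝk`:
`DV(x)[k × (x − x₀)] = k × V(x)` for `x ∈ U` — the steady vorticity equation `[ω, V] = νΔω = 0` read with `ω` a rotation
generator. -/
theorem fderiv_cross_eq_of_rigidVorticity (hU : IsOpen U) (hNS : IsSteadyNSOn U V p)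
    (hω : ∀ y ∈ U, curl V y = cross k (y - x₀)) {x : E3} (hx : x ∈ U) :
    fderiv ℝ V x (cross k (x - x₀)) = cross k (V x) := by
  obtain ⟨r, hr, hball⟩ := Metric.isOpen_iff.1 hU x hx
  have hV2 : ContDiffOn ℝ 2 V (ball x r) := (hNS.1.mono hball).of_le (by norm_num)
  have hcc := curl_convect_eq_zero_of_rigidVorticity hU hNS hω hx
  rw [curl_convect_self_local hr hV2, hNS.2.2.1 x hx, zero_smul, add_zero, convect_apply, convect_apply] at hcc
  have hcurlV : curl V =ᶠ[𝓝 x] fun y => cross k (y - x₀) := by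
    filter_upwards [hU.mem_nhds hx] with y hy using hω y hy
  rw [hcurlV.fderiv_eq, (hasFDerivAt_cross_sub k x₀ x).fderiv, crossCLM_apply, hω x hx] at hcc
  exact (sub_eq_zero.1 hcc).symm

/-! ## The rigid-vorticity stratum: constant swirl -/

/-- **The swirl has zero derivative.**  Under the same hypotheses the swirl `s(y) = ⟪V y, k × (y − x₀)⟫` about the axis
`x₀ + ℝk` has `Ds(x) = 0` at every `x ∈ U`: `Ds(x)h = ⟪DV h, ω⟫ + ⟪V, k × h⟫`, and by the spin identity and equivariance
`⟪DV h, ω⟫ = ⟪h, DV ω⟫ + ⟪ω × h, ω⟫ = ⟪h, k × V⟫`, which cancels the second term. -/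
theorem hasFDerivAt_swirl_zero_of_rigidVorticity (hU : IsOpen U) (hNS : IsSteadyNSOn U V p)
    (hω : ∀ y ∈ U, curl V y = cross k (y - x₀)) {x : E3} (hx : x ∈ U) :
    HasFDerivAt (fun y => ⟪V y, crossCLM k (y - x₀)⟫) (0 : E3 →L[ℝ] ℝ) x := by
  have hVd : DifferentiableAt ℝ V x :=
    (hNS.1.contDiffAt (hU.mem_nhds hx)).differentiableAt (by norm_num)
  have h := hVd.hasFDerivAt.inner ℝ (hasFDerivAt_cross_sub k x₀ x)
  simp only [crossCLM_apply]
  refine h.congr_fderiv ?_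
  ext h'
  rw [ContinuousLinearMap.comp_apply, ContinuousLinearMap.prod_apply, fderivInnerCLM_apply, zero_apply, crossCLM_apply]
  show ⟪V x, cross k h'⟫ + ⟪fderiv ℝ V x h', cross k (x - x₀)⟫ = 0
  -- `⟪V x, k × h'⟫ + ⟪DV h', k × (x − x₀)⟫ = 0`
  have hequi := fderiv_cross_eq_of_rigidVorticity hU hNS hω hx
  have hspin := inner_sub_inner_eq_inner_cross_curlCLM (fderiv ℝ V x) h' (cross k (x - x₀))
  rw [← curl_eq_curlCLM, hω x hx, inner_cross_self_left, hequi] at hspin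
  have hskew := inner_cross_add_inner_cross k (V x) h'
  linarith

/-- ★ **Constant swirl on the rigid-vorticity stratum.**  On a connected open `U` the swirl `⟪V x, k × (x − x₀)⟫` of such a flow
is constant (the card's `HasConstantSwirlOn`). -/
theorem hasConstantSwirlOn_of_rigidVorticity (hU : IsOpen U) (hUc : IsPreconnected U) (hNS : IsSteadyNSOn U V p)
    (hω : ∀ y ∈ U, curl V y = cross k (y - x₀)) : HasConstantSwirlOn U x₀ (crossCLM k) V := by
  have hd : ∀ x ∈ U, HasFDerivAt (fun y => ⟪V y, crossCLM k (y - x₀)⟫) (0 : E3 →L[ℝ] ℝ) x := fun x hx =>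
    hasFDerivAt_swirl_zero_of_rigidVorticity hU hNS hω hx
  obtain ⟨κ, hκ⟩ := hU.exists_is_const_of_fderiv_eq_zero hUc (fun x hx => (hd x hx).differentiableAt.differentiableWithinAt)
    (fun x hx => by rw [(hd x hx).fderiv]; rfl)
  exact ⟨κ, hκ⟩

/-- ★★ **RIGID-VORTICITY RIGIDITY.**  Let `(V, p)` be a steady Navier–Stokes flow on a connected open set `U ⊆ ℝ³` whose
vorticity is an infinitesimal rotation about `x₀` there, `curl V y = k × (y − x₀)` (`y ∈ U`, `k ≠ 0`).  Then the conclusion of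
C♭ / C♭₀ / C♯ holds on `U` with the explicit axis `A = k × ·`: `A` is a non-zero skew endomorphism, `V` is infinitesimally
`A`-equivariant about `x₀` on `U`, and its swirl about the axis `x₀ + ℝk` is constant on `U`. -/
theorem rigidity_of_rigidVorticity (hU : IsOpen U) (hUc : IsPreconnected U) (hNS : IsSteadyNSOn U V p) (hk : k ≠ 0)
    (hω : ∀ y ∈ U, curl V y = cross k (y - x₀)) :
    IsSkewAxis (crossCLM k) ∧ IsEquivariantOn U x₀ (crossCLM k) V ∧ HasConstantSwirlOn U x₀ (crossCLM k) V :=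
  ⟨isSkewAxis_crossCLM hk, fun x hx => by
    rw [crossCLM_apply, crossCLM_apply]; exact fderiv_cross_eq_of_rigidVorticity hU hNS hω hx,
    hasConstantSwirlOn_of_rigidVorticity hU hUc hNS hω⟩

/-- **Zero swirl when the axis meets `U`.**  If moreover some point `x₀ + t k` of the axis lies in `U`, the constant swirl is
`0`. -/
theorem swirl_eq_zero_of_rigidVorticity (hU : IsOpen U) (hUc : IsPreconnected U) (hNS : IsSteadyNSOn U V p)
    (hω : ∀ y ∈ U, curl V y = cross k (y - x₀)) {t : ℝ} (ht : x₀ + t • k ∈ U) {x : E3} (hx : x ∈ U) :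
    ⟪V x, cross k (x - x₀)⟫ = 0 := by
  obtain ⟨κ, hκ⟩ := hasConstantSwirlOn_of_rigidVorticity hU hUc hNS hω
  have hkk : cross k k = 0 := by
    ext i
    fin_cases i <;> simp [cross]
  have h0 := hκ _ ht
  rw [crossCLM_apply, add_sub_cancel_left, show cross k (t • k) = t • cross k k from map_smul (crossCLM k) t k, hkk,
    smul_zero, inner_zero_right] at h0
  have h1 := hκ x hx
  rw [crossCLM_apply] at h1
  rw [h1, ← h0]

/-! ## Corollaries in the shapes of the card's statements -/

/-- **Skew form.**  The same with the vorticity given as `A (y − x₀)` for a skew endomorphism `A` (`⟪A x, x⟫ = 0`): `A = k × ·`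
by `SilentShells.TwoAxes.exists_cross_of_skew`, and `A ≠ 0` as soon as the flow is vortical somewhere on `U`. -/
theorem rigidity_of_skewVorticity {A : E3 →L[ℝ] E3} (hU : IsOpen U) (hUc : IsPreconnected U) (hNS : IsSteadyNSOn U V p)
    (hA : ∀ x : E3, ⟪A x, x⟫ = 0) (hω : ∀ y ∈ U, curl V y = A (y - x₀)) (hvort : ∃ x ∈ U, curl V x ≠ 0) :
    IsSkewAxis A ∧ IsEquivariantOn U x₀ A V ∧ HasConstantSwirlOn U x₀ A V := by
  have hskew : ∀ x y : E3, ⟪A x, y⟫ = -⟪x, A y⟫ := fun x y => by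
    have hxy := hA (x + y)
    rw [map_add, inner_add_left, inner_add_right, inner_add_right, hA x, hA y, zero_add, add_zero] at hxy
    rw [real_inner_comm (A y) x]
    linarith
  obtain ⟨k, hk⟩ := SilentShells.TwoAxes.exists_cross_of_skew A hskew
  have hAk : A = crossCLM k := by ext1 x; rw [hk x, crossCLM_apply]
  subst hAk
  have hk0 : k ≠ 0 := by
    obtain ⟨x, hx, hne⟩ := hvort
    rintro rfl
    exact hne (by rw [hω x hx, crossCLM_apply]; simp [cross])
  exact rigidity_of_rigidVorticity hU hUc hNS hk0 (fun y hy => by rw [hω y hy, crossCLM_apply])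

end Main

/-- **(ball form — the shape of C♭₀ `SteadyLocalRigidityOffCentreUnrestricted`)**  On every ball and for every centre `x₀`:
a steady NS flow on `ball x₁ ρ` whose vorticity there is an infinitesimal rotation `k × (y − x₀)`, `k ≠ 0`, is infinitesimally
axisymmetric about an axis through `x₀` with constant swirl on the ball.  (C♭₀ itself — the same conclusion for ALL analytic
unthreaded vortical steady flows on balls — is FALSE, `AzimuthalCartan.not_steadyLocalRigidityOffCentreUnrestricted`, p717512:
its witnesses `crossFlow γ` have azimuthal but NON-rigid vorticity `−G′_γ(ρ) e_φ`.) -/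
theorem steadyLocalRigidity_of_rigidVorticity_ball (V : E3 → E3) (p : E3 → ℝ) (x₀ x₁ k : E3) (ρ : ℝ)
    (hNS : IsSteadyNSOn (ball x₁ ρ) V p) (hk : k ≠ 0) (hω : ∀ y ∈ ball x₁ ρ, curl V y = cross k (y - x₀)) :
    ∃ A : E3 →L[ℝ] E3, IsSkewAxis A ∧ IsEquivariantOn (ball x₁ ρ) x₀ A V ∧ HasConstantSwirlOn (ball x₁ ρ) x₀ A V :=
  ⟨crossCLM k, rigidity_of_rigidVorticity isOpen_ball (convex_ball x₁ ρ).isPreconnected hNS hk hω⟩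

/-- A spherical shell `r₁ < |x − x₀| < r₂` with `0 ≤ r₁` is preconnected (image of `(r₁, r₂) × S²` under `(t, u) ↦ x₀ + t u`). -/
theorem isPreconnected_shell (x₀ : E3) {r₁ r₂ : ℝ} (hr₁ : 0 ≤ r₁) : IsPreconnected (shell x₀ r₁ r₂) := by
  have hrank : 1 < Module.rank ℝ E3 := by
    rw [← Module.finrank_eq_rank, finrank_euclideanSpace_fin]; norm_num
  have himage : (fun q : ℝ × E3 => x₀ + q.1 • q.2) '' (Ioo r₁ r₂ ×ˢ sphere (0 : E3) 1) = shell x₀ r₁ r₂ := by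
    ext x
    simp only [mem_image, mem_prod, mem_Ioo, mem_sphere_iff_norm, sub_zero, shell, mem_setOf_eq, Prod.exists]
    constructor
    · rintro ⟨t, u, ⟨⟨h1, h2⟩, hu⟩, rfl⟩
      have ht : 0 < t := lt_of_le_of_lt hr₁ h1
      have hd : dist (x₀ + t • u) x₀ = t := by
        rw [dist_eq_norm, add_sub_cancel_left, norm_smul, hu, mul_one, Real.norm_of_nonneg ht.le]
      rw [hd]; exact ⟨h1, h2⟩
    · rintro ⟨h1, h2⟩
      have ht : 0 < dist x x₀ := lt_of_le_of_lt hr₁ h1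
      have hne : x - x₀ ≠ 0 := by
        rw [← norm_ne_zero_iff, ← dist_eq_norm]; exact ht.ne'
      refine ⟨dist x x₀, (dist x x₀)⁻¹ • (x - x₀), ⟨⟨h1, h2⟩, ?_⟩, ?_⟩
      · rw [norm_smul, norm_inv, ← dist_eq_norm, Real.norm_of_nonneg dist_nonneg, inv_mul_cancel₀ ht.ne']
      · rw [smul_smul, mul_inv_cancel₀ ht.ne', one_smul, add_sub_cancel]
  rw [← himage]
  refine ((isPreconnected_Ioo).prod (isPreconnected_sphere hrank (0 : E3) 1)).image _ ?_
  exact (continuous_const.add (continuous_fst.smul continuous_snd)).continuousOn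

/-- ★ **(shell form — the shape of C♯ `SteadyShellRigidity`)**  C♯ HOLDS on the rigid-vorticity stratum: a steady NS flow on a full
shell `shell x₀ r₁ r₂` (`0 ≤ r₁`) whose vorticity there is an infinitesimal rotation `k × (y − x₀)`, `k ≠ 0`, is infinitesimally
axisymmetric about an axis through `x₀` with constant swirl on the shell (no analyticity and no unthreaded hypothesis needed: the
rigid rotation field is automatically tangent to the spheres about `x₀`). -/
theorem steadyShellRigidity_of_rigidVorticity (V : E3 → E3) (p : E3 → ℝ) (x₀ k : E3) (r₁ r₂ : ℝ) (hr₁ : 0 ≤ r₁)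
    (hNS : IsSteadyNSOn (shell x₀ r₁ r₂) V p) (hk : k ≠ 0) (hω : ∀ y ∈ shell x₀ r₁ r₂, curl V y = cross k (y - x₀)) :
    ∃ A : E3 →L[ℝ] E3, IsSkewAxis A ∧ IsEquivariantOn (shell x₀ r₁ r₂) x₀ A V ∧ HasConstantSwirlOn (shell x₀ r₁ r₂) x₀ A V :=
  ⟨crossCLM k, rigidity_of_rigidVorticity (isOpen_shell x₀ r₁ r₂) (isPreconnected_shell x₀ hr₁) hNS hk hω⟩

/-- **Rigid vorticity is unthreaded**: `⟪y − x₀, k × (y − x₀)⟫ = 0`, so the stratum lies inside the card's hypothesis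
`IsUnthreadedOn U x₀ V`. -/
theorem isUnthreadedOn_of_rigidVorticity {V : E3 → E3} {U : Set E3} {x₀ k : E3}
    (hω : ∀ y ∈ U, curl V y = cross k (y - x₀)) : IsUnthreadedOn U x₀ V := fun y hy => by
  rw [hω y hy, real_inner_comm]
  exact inner_cross_self_right k (y - x₀)

end Summit.NavierStokesRegularity.NavierStokesRegularity.Theorems.PoloidalLiouville.AzimuthalCartan.RigidVorticity

end
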